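import Summits.QuantumFields.QCD.Theorems.HeatSlicedQuarksRobustYangMillsHandoverStubMatrixAffinePathCalculus
import Mathlib.Analysis.Calculus.Deriv.Mul
import Mathlib.Analysis.Calculus.Deriv.Add
import Mathlib.Analysis.Complex.RealDeriv
import HarnessLib

/-!
# Stub `stub_oneStep_path_hasDerivAt` of line `pin-the-infimum` (crux `RobustYangMillsHandover`, 8892)

E2, layer W2-1a of the fermionic-insertion bricks in Lüscher's transfer-matrix representation of
the QCD torus functional. A quark-bilinear source `s` placed at one time slice perturbs the two
chain blocks of Lüscher's reduction AFFINELY, `E(s) = E - s K₁` and `F(s) = F - s K₂` (`E`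
invertible), so the one-step matrix `N(s) = -E(s)⁻¹ F(s)` is differentiable at `s = 0` with

  `N'(0) = -E⁻¹ K₁ E⁻¹ F + E⁻¹ K₂`

(product rule, with `d/ds E(s)⁻¹|₀ = E⁻¹ K₁ E⁻¹` and `d/ds F(s)|₀ = -K₂`). The statement is
entrywise (complex-valued functions of the real parameter `s`), so no matrix norm appears in it.

## Proof

Entry `(i, j)` of the product is the finite sum `∑ₖ (E - sK₁)⁻¹ᵢₖ (F - sK₂)ₖⱼ` (`Matrix.mul_apply`).
Each summand is a product of two differentiable scalar functions: the entry of the inverse, with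
derivative `(E⁻¹ K₁ E⁻¹)ᵢₖ` at `0` (the landed wave-1 stub
`StubMatrixAffinePathCalculus.hasDerivAt_inv_sub_smul_apply_complex`), and the affine entry
`Fₖⱼ - s (K₂)ₖⱼ`, with derivative `-(K₂)ₖⱼ`. The product rule (`HasDerivAt.fun_mul`), the sum rule
(`HasDerivAt.fun_sum`) and `HasDerivAt.fun_neg` give the derivative
`-(∑ₖ ((E⁻¹K₁E⁻¹)ᵢₖ Fₖⱼ - E⁻¹ᵢₖ (K₂)ₖⱼ)) = (-(E⁻¹K₁E⁻¹F) + E⁻¹K₂)ᵢⱼ`. Everything is first done for a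
complex parameter and then restricted to the real line with `HasDerivAt.comp_ofReal`.

References: J. R. Magnus, H. Neudecker, *Matrix Differential Calculus*, 3rd ed. (Wiley 2019),
Ch. 8 (differential of the inverse, product rule); M. Lüscher, Comm. Math. Phys. 54 (1977) 283
(transfer-matrix reduction of the lattice fermion determinant).
-/

namespace Summit.QuantumFields.QCD.Cruxes.RobustYangMillsHandover.PinTheInfimum

namespace StubOneStepPathHasDerivAt

variable {n : Type*} [Fintype n] [DecidableEq n]

omit [Fintype n] [DecidableEq n] in
/-- **Entries of an affine matrix path are affine**: `d/dz (F - z K)ₖⱼ = -Kₖⱼ` (complex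
parameter, at `z = 0`). [folklore] -/
theorem hasDerivAt_sub_smul_apply_complex (F K : Matrix n n ℂ) (k j : n) :
    HasDerivAt (fun z : ℂ => (F - z • K) k j) (-(K k j)) 0 := by
  simp only [Matrix.sub_apply, Matrix.smul_apply, smul_eq_mul]
  exact (hasDerivAt_mul_const (K k j)).const_sub (F k j)

/-- **Product rule for one summand of the `(i, j)` entry of `(E - zK₁)⁻¹ (F - zK₂)`**: for
invertible `E`, `d/dz ((E - zK₁)⁻¹ᵢₖ (F - zK₂)ₖⱼ)|₀ = (E⁻¹K₁E⁻¹)ᵢₖ Fₖⱼ - E⁻¹ᵢₖ (K₂)ₖⱼ`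
(complex parameter). [folklore] -/
theorem hasDerivAt_inv_mul_summand_complex {E : Matrix n n ℂ} (F K₁ K₂ : Matrix n n ℂ)
    (hE : IsUnit E.det) (i k j : n) :
    HasDerivAt (fun z : ℂ => (E - z • K₁)⁻¹ i k * (F - z • K₂) k j)
      ((E⁻¹ * K₁ * E⁻¹) i k * F k j - E⁻¹ i k * K₂ k j) 0 := by
  have h := (StubMatrixAffinePathCalculus.hasDerivAt_inv_sub_smul_apply_complex K₁ hE i k).fun_mul
    (hasDerivAt_sub_smul_apply_complex F K₂ k j)
  refine h.congr_deriv ?_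
  rw [zero_smul, zero_smul, sub_zero, sub_zero, mul_neg, ← sub_eq_add_neg]

/-- **Derivative of the perturbed one-step matrix, complex parameter**: for invertible `E`,
every entry of `z ↦ -(E - zK₁)⁻¹ (F - zK₂)` is differentiable at `z = 0` with derivative
`(-(E⁻¹K₁E⁻¹F) + E⁻¹K₂)ᵢⱼ` (sum over `k` of `hasDerivAt_inv_mul_summand_complex`, then
negation). [folklore] -/
theorem hasDerivAt_neg_inv_mul_apply_complex {E : Matrix n n ℂ} (F K₁ K₂ : Matrix n n ℂ)
    (hE : IsUnit E.det) (i j : n) :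
    HasDerivAt (fun z : ℂ => (-((E - z • K₁)⁻¹ * (F - z • K₂))) i j)
      ((-(E⁻¹ * K₁ * E⁻¹ * F) + E⁻¹ * K₂) i j) 0 := by
  -- the entry as (minus) a finite sum of products
  have hfun : (fun z : ℂ => (-((E - z • K₁)⁻¹ * (F - z • K₂))) i j) =
      fun z : ℂ => -(∑ k, (E - z • K₁)⁻¹ i k * (F - z • K₂) k j) := by
    funext z
    rw [Matrix.neg_apply, Matrix.mul_apply]
  -- the value of the derivative
  have hval : -(∑ k, ((E⁻¹ * K₁ * E⁻¹) i k * F k j - E⁻¹ i k * K₂ k j)) =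
      (-(E⁻¹ * K₁ * E⁻¹ * F) + E⁻¹ * K₂) i j := by
    rw [Finset.sum_sub_distrib, neg_sub, Matrix.add_apply, Matrix.neg_apply, neg_add_eq_sub,
      Matrix.mul_apply, Matrix.mul_apply]
  have h := (HasDerivAt.fun_sum (u := Finset.univ)
    (fun k _ => hasDerivAt_inv_mul_summand_complex F K₁ K₂ hE i k j)).fun_neg
  rw [hfun]
  exact h.congr_deriv hval

/-- **Derivative of the perturbed one-step matrix, real parameter**: for invertible `E`,
`d/ds (-(E - sK₁)⁻¹ (F - sK₂))ᵢⱼ |_{s = 0} = (-(E⁻¹K₁E⁻¹F) + E⁻¹K₂)ᵢⱼ` (`s : ℝ` coerced to `ℂ`).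
[folklore] -/
theorem hasDerivAt_neg_inv_mul_apply {E : Matrix n n ℂ} (F K₁ K₂ : Matrix n n ℂ)
    (hE : IsUnit E.det) (i j : n) :
    HasDerivAt (fun s : ℝ => (-((E - (s : ℂ) • K₁)⁻¹ * (F - (s : ℂ) • K₂))) i j)
      ((-(E⁻¹ * K₁ * E⁻¹ * F) + E⁻¹ * K₂) i j) 0 := by
  have h := hasDerivAt_neg_inv_mul_apply_complex F K₁ K₂ hE i j
  rw [← Complex.ofReal_zero] at h
  exact h.comp_ofReal

end StubOneStepPathHasDerivAt

/-- **E2 W2-1a: derivative of the perturbed one-step matrix of Lüscher's reduction.** A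
quark-bilinear source `s` at one time slice perturbs the chain blocks affinely,
`E(s) = E - sK₁`, `F(s) = F - sK₂` (`E` invertible, complex `n × n` matrices, real parameter);
the one-step matrix `N(s) = -E(s)⁻¹F(s)` then satisfies, entrywise,
`d/ds N(s)ᵢⱼ |_{s = 0} = (-(E⁻¹K₁E⁻¹F) + E⁻¹K₂)ᵢⱼ` — the product rule combined with the
derivative of the inverse `d/ds E(s)⁻¹|₀ = E⁻¹K₁E⁻¹` (Magnus–Neudecker, *Matrix Differential
Calculus*, Ch. 8). The statement is the registered stub signature verbatim. [folklore] -/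
theorem stub_oneStep_path_hasDerivAt :
    ∀ (n : Type) [Fintype n] [DecidableEq n] (E F K₁ K₂ : Matrix n n ℂ), IsUnit E.det →
      ∀ i j, HasDerivAt (fun s : ℝ => (-((E - (s : ℂ) • K₁)⁻¹ * (F - (s : ℂ) • K₂))) i j)
        ((-(E⁻¹ * K₁ * E⁻¹ * F) + E⁻¹ * K₂) i j) 0 := by
  intro n _ _ E F K₁ K₂ hE i j
  exact StubOneStepPathHasDerivAt.hasDerivAt_neg_inv_mul_apply F K₁ K₂ hE i j

end Summit.QuantumFields.QCD.Cruxes.RobustYangMillsHandover.PinTheInfimum
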